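import Summits.HodgeConjecture.CorCM.Census.CentralSquaresPartnersCompanion
import Summits.HodgeConjecture.CorCM.Census.CentralSquaresPartnersPairRelation
import Summits.HodgeConjecture.CorCM.Census.CentralSquaresFourTypeLaw

/-!
# The square-central class, LV: the doubled classes `2Y_s`, `2Y'_a` at a dihedral-type partner of a MULTI-PARTNER base block

COR-CM (cell `pub-hodgecm2`), count-neutral kernel combinatorics by the binder seat b09 (gen 50; lane SQUARE-CENTRAL CLASS, part LV), on parts LI
(`rel_transversal_mem_partners`), LII (`Y_sub_Y_mem_partners`, `Y'_sub_Y'_mem_partners`, the companion partner set `insert T̄₁ (𝒯.erase T₁)`: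
`companion_base_partners`, `companion_card_partners`, `companion_pair_partners`), LIV (`rel_transversal_pair_mem_partners`), part VII (`companion_rt`,
`companion_sq`, `companion_swap`, `or_companion_iff`) and part VIII (`ne_rep`), all BY NAME.  Theorems only: no definition, no `decide`, no certificate, no
named fact, no `sorry`.  HONEST FRAMING: `HC_CM` is NOT proved, here or anywhere in the tree; nothing here is a period or a headline.

THE SETTING of parts LI–LIV (multi-partner block; dihedral-type partner `T₁`, swap `Q`; strict lowering cover in a base-change stable `L ⊇ ℤ⟨pairs⟩`;
transversals `T ⊆ 𝓗`, `T' ⊆ T₀ ∩ T₁` of size `m ≥ 3`; tie hypotheses `hties`, `htiesC`; far hypotheses at the level-`(m+2)` classes of `T` and, in the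
companion frame `(T₀; T̄₁, cQ)`, of `T'`).

* §1 `Y'_add_Y'_mem_partners`: `Y'_a + Y'_{σa} ∈ L` (part LIVʼs pair relation minus part LIʼs `R(T)`).
* §2 `Y_add_Y_mem_partners`: `Y_s + Y_{σs} ∈ L` — §1 in the companion multi-partner frame, modulo pairs.
* §3 **`two_smul_Y'_mem_partners`**: `2Y'_a ∈ L` for every `a ∈ T₀ ∩ T₁`; §4 **`two_smul_Y_mem_partners`**: `2Y_s ∈ L` for every `s ∈ 𝓗`.
Together with `R(T)` (LI) and `Rᶜ(T')` (LII) these are the four relation families of part XLIXʼs multi-partner residual closure at the partner `T₁`;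
the law for a block all of whose partners are of dihedral type is assembled in `Census/CentralSquaresPartnersLaw.lean`.

## References
* [Pohlmann1968] H. Pohlmann, Algebraic cycles on abelian varieties of complex multiplication type, Ann. of Math. 88 (1968), Thm 1.
-/

namespace Summit.HodgeConjecture.CorCM.Census.CentralSquares

open Finset
open scoped symmDiff
open Summit.HodgeConjecture.CorCM.Prior.AllgGroup.RfwfAllgGroup
open Summit.HodgeConjecture.CorCM.Census.BlockParity
open Summit.HodgeConjecture.CorCM.Census.Coinvariant
open Summit.HodgeConjecture.CorCM.Census.TwistGeneration
open Summit.HodgeConjecture.CorCM.Census.BaseBlock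
open Summit.HodgeConjecture.CorCM.Census.CoverClosure

noncomputable section

variable {G : Type*} [Group G] [Fintype G] [DecidableEq G] (c : G)

section Frame

variable (hc2 : c * c = 1) (hcen : ∀ x : G, x * c = c * x) (T₀ : CMF G c) (𝒯 : Finset (CMF G c))
variable (hbase : ∀ Q : G, rt c Q T₀ = T₀ ∨ rt c Q T₀ = rt c c T₀ ∨ ∃ T₁ ∈ 𝒯, rt c Q T₀ = T₁ ∨ rt c Q T₀ = rt c c T₁)
variable (m : ℕ) (hn : T₀.1.card = 4 * m) (hH : ∀ T₁ ∈ 𝒯, (T₀.1 \ T₁.1).card = 2 * m)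
variable (hpair : ∀ T₁ ∈ 𝒯, ∀ T₂ ∈ 𝒯, T₁ ≠ T₂ → ((T₀.1 \ T₁.1) ∆ (T₀.1 \ T₂.1)).card = 2 * m)
variable (T₁ : CMF G c) (hT₁ : T₁ ∈ 𝒯) (Q : G) (hQ : rt c Q T₀ = T₁) (hQQ : Q * Q = 1)
variable (hσH : ∀ t ∈ T₀.1, ∀ t' ∈ T₀.1, (t' = t * Q ∨ t' = c * (t * Q)) → (t ∈ T₀.1 \ T₁.1 ↔ t' ∈ T₀.1 \ T₁.1))
variable (L : Submodule ℤ (CMF G c →₀ ℤ)) (hLrt : ∀ (Q' : G) (y : CMF G c →₀ ℤ), y ∈ L → Finsupp.mapDomain (rt c Q') y ∈ L)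
variable (hP : ∀ Ψ : CMF G c, pair c Ψ ∈ L)
variable (hcover : ∀ Ψ : CMF G c, 2 ≤ bpot c T₀ Ψ → ∃ Q₂ s s' : G, bpot c T₀ Ψ = ddist (rt c Q₂ T₀) Ψ ∧
    s ∈ (rt c Q₂ T₀).1 \ Ψ.1 ∧ s' ∈ (rt c Q₂ T₀).1 \ Ψ.1 ∧ s ≠ s' ∧
    gface c hc2 Ψ s s' ∈ L ∧
    ((∃ Q₁ t t' : G, bpot c T₀ Ψ = ddist (rt c Q₁ T₀) Ψ ∧ t ∈ (rt c Q₁ T₀).1 \ Ψ.1 ∧ t' ∈ (rt c Q₁ T₀).1 \ Ψ.1 ∧ t ≠ t' ∧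
        (∀ Q' : G, ddist (rt c Q' T₀) (oflipCM c hc2 t Ψ) = bpot c T₀ (oflipCM c hc2 t Ψ) → rt c Q' T₀ = rt c Q₁ T₀) ∧
        (∀ Q' : G, ddist (rt c Q' T₀) (oflipCM c hc2 t' Ψ) = bpot c T₀ (oflipCM c hc2 t' Ψ) → rt c Q' T₀ = rt c Q₁ T₀) ∧
        (∀ Q' : G, ddist (rt c Q' T₀) (oflipCM c hc2 t (oflipCM c hc2 t' Ψ)) = bpot c T₀ (oflipCM c hc2 t (oflipCM c hc2 t' Ψ)) →
          rt c Q' T₀ = rt c Q₁ T₀)) →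
      (∀ Q' : G, ddist (rt c Q' T₀) (oflipCM c hc2 s Ψ) = bpot c T₀ (oflipCM c hc2 s Ψ) → rt c Q' T₀ = rt c Q₂ T₀) ∧
      (∀ Q' : G, ddist (rt c Q' T₀) (oflipCM c hc2 s' Ψ) = bpot c T₀ (oflipCM c hc2 s' Ψ) → rt c Q' T₀ = rt c Q₂ T₀) ∧
      (∀ Q' : G, ddist (rt c Q' T₀) (oflipCM c hc2 s (oflipCM c hc2 s' Ψ)) = bpot c T₀ (oflipCM c hc2 s (oflipCM c hc2 s' Ψ)) →
        rt c Q' T₀ = rt c Q₂ T₀)))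
variable (hties : ∀ T : Finset G, T ⊆ T₀.1 \ T₁.1 → T.card = m →
    (∀ t ∈ T₀.1 \ T₁.1, ∀ t' ∈ T₀.1, (t' = t * Q ∨ t' = c * (t * Q)) → (t ∈ T ↔ t' ∉ T)) →
    ∀ X : CMF G c, T₀.1 \ X.1 = T → ∀ Q' : G, ddist (rt c Q' T₀) X = m → rt c Q' T₀ = T₀ ∨ rt c Q' T₀ = T₁)
variable (htiesC : ∀ T' : Finset G, T' ⊆ T₀.1 ∩ T₁.1 → T'.card = m →
    (∀ t ∈ T₀.1 ∩ T₁.1, ∀ t' ∈ T₀.1, (t' = t * Q ∨ t' = c * (t * Q)) → (t ∈ T' ↔ t' ∉ T')) →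
    ∀ X : CMF G c, T₀.1 \ X.1 = T' → ∀ Q' : G, ddist (rt c Q' T₀) X = m → rt c Q' T₀ = T₀ ∨ rt c Q' T₀ = rt c c T₁)

/-! ## §1 `Y'_a + Y'_{σa}` -/

include hcen hbase hn hH hpair hT₁ hQ hQQ hσH hLrt hcover hties in
/-- **`Y'_a + Y'_{σa} ∈ L` in a multi-partner block** (`m ≥ 3`): for a transversal `T ⊆ 𝓗` of size `m`, `a ∈ T₀ ∩ T₁` with swap image `a' ≠ a`, and the
other partners far from the two level-`(m+2)` classes (`hfar₀`, `hfar₁`). [folklore] -/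
theorem Y'_add_Y'_mem_partners (hm : 3 ≤ m) (T : Finset G) (hTH : T ⊆ T₀.1 \ T₁.1) (hTm : T.card = m)
    (hT : ∀ t ∈ T₀.1 \ T₁.1, ∀ t' ∈ T₀.1, (t' = t * Q ∨ t' = c * (t * Q)) → (t ∈ T ↔ t' ∉ T))
    {a a' : G} (ha : a ∈ T₀.1) (ha1 : a ∈ T₁.1) (ha' : a' ∈ T₀.1) (haa' : a' = a * Q ∨ a' = c * (a * Q)) (hne : a ≠ a')
    (hfar₀ : ∀ T₂ ∈ 𝒯, T₂ ≠ T₁ → ∀ X : CMF G c, T₀.1 \ X.1 ⊆ T ∪ {a, a'} →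
      (T₀.1 \ X.1).card < ddist T₂ X ∧ (T₀.1 \ X.1).card < ddist (rt c c T₂) X)
    (hfar₁ : ∀ T₂ ∈ 𝒯, T₂ ≠ T₁ → ∀ X : CMF G c, T₁.1 \ X.1 ⊆ ((T₀.1 \ T₁.1) \ T).image (fun x => c * x) ∪ {a, a'} →
      (T₁.1 \ X.1).card < ddist T₂ X ∧ (T₁.1 \ X.1).card < ddist (rt c c T₂) X) :
    ((Finsupp.single (oflipCM c hc2 a T₀) (1 : ℤ) - Finsupp.single T₀ 1) - (Finsupp.single (oflipCM c hc2 a T₁) (1 : ℤ) - Finsupp.single T₁ 1)) +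
      ((Finsupp.single (oflipCM c hc2 a' T₀) (1 : ℤ) - Finsupp.single T₀ 1) - (Finsupp.single (oflipCM c hc2 a' T₁) (1 : ℤ) - Finsupp.single T₁ 1))
      ∈ L := by
  have h1 := rel_transversal_mem_partners c hc2 hcen T₀ 𝒯 hbase m hn hH hpair T₁ hT₁ Q hQ hQQ L hLrt hcover (by omega) hσH T hTH hTm hT
    (hties T hTH hTm hT)
  have h2 := rel_transversal_pair_mem_partners c hc2 hcen T₀ 𝒯 hbase m hn hH hpair T₁ hT₁ Q hQ hQQ L hLrt hcover hm hσH T hTH hTm hT ha ha1 ha'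
    haa' hne hfar₀ hfar₁
  have h := Submodule.sub_mem _ h2 h1
  rwa [add_assoc, add_sub_cancel_left] at h

/-! ## §2 `Y_s + Y_{σs}` (companion frame) -/

include hcen hbase hn hH hpair hT₁ hQ hQQ hσH hLrt hP hcover htiesC in
/-- **`Y_s + Y_{σs} ∈ L` in a multi-partner block** (`m ≥ 3`, pairs in `L`): for a transversal `T' ⊆ T₀ ∩ T₁` of size `m`, `s ∈ 𝓗` with swap image
`s' ≠ s`, and the other partners far from the two level-`(m+2)` classes of the companion frame `(T₀; T̄₁, cQ)` (`hfar₀`, `hfar₁`). [folklore] -/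
theorem Y_add_Y_mem_partners (hm : 3 ≤ m) (T' : Finset G) (hTH : T' ⊆ T₀.1 ∩ T₁.1) (hTm : T'.card = m)
    (hT : ∀ t ∈ T₀.1 ∩ T₁.1, ∀ t' ∈ T₀.1, (t' = t * Q ∨ t' = c * (t * Q)) → (t ∈ T' ↔ t' ∉ T'))
    {s s' : G} (hs : s ∈ T₀.1 \ T₁.1) (hs' : s' ∈ T₀.1) (hss' : s' = s * Q ∨ s' = c * (s * Q)) (hne : s ≠ s')
    (hfar₀ : ∀ T₂ ∈ 𝒯, T₂ ≠ T₁ → ∀ X : CMF G c, T₀.1 \ X.1 ⊆ T' ∪ {s, s'} →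
      (T₀.1 \ X.1).card < ddist T₂ X ∧ (T₀.1 \ X.1).card < ddist (rt c c T₂) X)
    (hfar₁ : ∀ T₂ ∈ 𝒯, T₂ ≠ T₁ → ∀ X : CMF G c,
      (rt c c T₁).1 \ X.1 ⊆ ((T₀.1 \ (rt c c T₁).1) \ T').image (fun x => c * x) ∪ {s, s'} →
      ((rt c c T₁).1 \ X.1).card < ddist T₂ X ∧ ((rt c c T₁).1 \ X.1).card < ddist (rt c c T₂) X) :
    ((Finsupp.single (oflipCM c hc2 s T₀) (1 : ℤ) - Finsupp.single T₀ 1) + (Finsupp.single (oflipCM c hc2 s T₁) (1 : ℤ) - Finsupp.single T₁ 1)) +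
      ((Finsupp.single (oflipCM c hc2 s' T₀) (1 : ℤ) - Finsupp.single T₀ 1) + (Finsupp.single (oflipCM c hc2 s' T₁) (1 : ℤ) - Finsupp.single T₁ 1))
      ∈ L := by
  classical
  have hHc : T₀.1 \ (rt c c T₁).1 = T₀.1 ∩ T₁.1 := by
    rw [dev_compl c hcen T₀ T₁]; ext t; simp only [mem_sdiff, mem_inter, not_and, not_not]; tauto
  have hT2 : ∀ t ∈ T₀.1 \ (rt c c T₁).1, ∀ t' ∈ T₀.1, (t' = t * (c * Q) ∨ t' = c * (t * (c * Q))) → (t ∈ T' ↔ t' ∉ T') := by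
    intro t ht t' ht' h
    rw [or_companion_iff c hc2 hcen Q] at h
    rw [hHc] at ht
    exact hT t ht t' ht' h
  have hties' : ∀ T : Finset G, T ⊆ T₀.1 \ (rt c c T₁).1 → T.card = m →
      (∀ t ∈ T₀.1 \ (rt c c T₁).1, ∀ t' ∈ T₀.1, (t' = t * (c * Q) ∨ t' = c * (t * (c * Q))) → (t ∈ T ↔ t' ∉ T)) →
      ∀ X : CMF G c, T₀.1 \ X.1 = T → ∀ Q' : G, ddist (rt c Q' T₀) X = m → rt c Q' T₀ = T₀ ∨ rt c Q' T₀ = rt c c T₁ := by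
    intro T hTH' hTm' hT'
    rw [hHc] at hTH'
    refine htiesC T hTH' hTm' fun t ht t' ht' h => ?_
    exact hT' t (by rw [hHc]; exact ht) t' ht' ((or_companion_iff c hc2 hcen Q t t').mpr h)
  have hs1 : s ∈ (rt c c T₁).1 := by rw [rt_self_val c hcen]; exact mem_sdiff.mpr ⟨mem_univ _, (mem_sdiff.mp hs).2⟩
  -- the far hypotheses in the companion partner set
  have hne₁ : ∀ T₂ ∈ insert (rt c c T₁) (𝒯.erase T₁), T₂ ≠ rt c c T₁ → T₂ ∈ 𝒯 ∧ T₂ ≠ T₁ := by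
    intro T₂ hT₂ hne₂
    rcases mem_insert.mp hT₂ with h | h
    · exact absurd h hne₂
    · exact ⟨mem_of_mem_erase h, (mem_erase.mp h).1⟩
  have hfar₀' : ∀ T₂ ∈ insert (rt c c T₁) (𝒯.erase T₁), T₂ ≠ rt c c T₁ → ∀ X : CMF G c, T₀.1 \ X.1 ⊆ T' ∪ {s, s'} →
      (T₀.1 \ X.1).card < ddist T₂ X ∧ (T₀.1 \ X.1).card < ddist (rt c c T₂) X :=
    fun T₂ hT₂ hne₂ => hfar₀ T₂ (hne₁ T₂ hT₂ hne₂).1 (hne₁ T₂ hT₂ hne₂).2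
  have hfar₁' : ∀ T₂ ∈ insert (rt c c T₁) (𝒯.erase T₁), T₂ ≠ rt c c T₁ → ∀ X : CMF G c,
      (rt c c T₁).1 \ X.1 ⊆ ((T₀.1 \ (rt c c T₁).1) \ T').image (fun x => c * x) ∪ {s, s'} →
      ((rt c c T₁).1 \ X.1).card < ddist T₂ X ∧ ((rt c c T₁).1 \ X.1).card < ddist (rt c c T₂) X :=
    fun T₂ hT₂ hne₂ => hfar₁ T₂ (hne₁ T₂ hT₂ hne₂).1 (hne₁ T₂ hT₂ hne₂).2
  have h := Y'_add_Y'_mem_partners c hc2 hcen T₀ (insert (rt c c T₁) (𝒯.erase T₁)) (companion_base_partners c hc2 hbase) m hn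
    (companion_card_partners c hcen T₀ 𝒯 m hn hH hT₁) (companion_pair_partners c hcen T₀ 𝒯 m hn hpair hT₁) (rt c c T₁) (mem_insert_self _ _)
    (c * Q) (companion_rt c T₀ T₁ Q hQ) (companion_sq c hc2 hcen Q hQQ) (companion_swap c hc2 hcen T₀ T₁ Q hσH) L hLrt hcover hties' hm
    T' (by rw [hHc]; exact hTH) hTm hT2 (mem_sdiff.mp hs).1 hs1 hs' ((or_companion_iff c hc2 hcen Q s s').mpr hss') hne hfar₀' hfar₁'
  have hsr : ∀ X : CMF G c, Finsupp.single (rt c c X) (1 : ℤ) = pair c X - Finsupp.single X 1 := fun X => by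
    rw [pair, add_sub_cancel_left]
  simp only [oflipCM_rt_self c hc2 hcen, hsr] at h
  have hp : pair c (oflipCM c hc2 s T₁) + pair c (oflipCM c hc2 s' T₁) - (2 : ℤ) • pair c T₁ ∈ L :=
    Submodule.sub_mem _ (Submodule.add_mem _ (hP _) (hP _)) (Submodule.smul_mem _ _ (hP _))
  have e : ((Finsupp.single (oflipCM c hc2 s T₀) (1 : ℤ) - Finsupp.single T₀ 1) + (Finsupp.single (oflipCM c hc2 s T₁) (1 : ℤ) - Finsupp.single T₁ 1)) +
      ((Finsupp.single (oflipCM c hc2 s' T₀) (1 : ℤ) - Finsupp.single T₀ 1) + (Finsupp.single (oflipCM c hc2 s' T₁) (1 : ℤ) - Finsupp.single T₁ 1)) =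
      (((Finsupp.single (oflipCM c hc2 s T₀) (1 : ℤ) - Finsupp.single T₀ 1) -
          ((pair c (oflipCM c hc2 s T₁) - Finsupp.single (oflipCM c hc2 s T₁) 1) - (pair c T₁ - Finsupp.single T₁ 1))) +
        ((Finsupp.single (oflipCM c hc2 s' T₀) (1 : ℤ) - Finsupp.single T₀ 1) -
          ((pair c (oflipCM c hc2 s' T₁) - Finsupp.single (oflipCM c hc2 s' T₁) 1) - (pair c T₁ - Finsupp.single T₁ 1)))) +
      (pair c (oflipCM c hc2 s T₁) + pair c (oflipCM c hc2 s' T₁) - (2 : ℤ) • pair c T₁) := by module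
  rw [e]
  exact Submodule.add_mem _ h hp

/-! ## §3 `2Y'_a` -/

include hc2 hcen hbase hn hH hpair hT₁ hQ hQQ hσH hLrt hP hcover hties htiesC in
/-- **`2Y'_a ∈ L` for every `a ∈ T₀ ∩ T₁`** (multi-partner block, `m ≥ 3`): from a transversal `T ⊆ 𝓗` whose level-`(m+2)` classes are far from the
other partners for every outside pair `{a, σa}` (`hfarT`), and a transversal `T' ⊆ T₀ ∩ T₁` (tie hypothesis `htiesC`). [folklore] -/
theorem two_smul_Y'_mem_partners (hm : 3 ≤ m) (T : Finset G) (hTH : T ⊆ T₀.1 \ T₁.1) (hTm : T.card = m)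
    (hT : ∀ t ∈ T₀.1 \ T₁.1, ∀ t' ∈ T₀.1, (t' = t * Q ∨ t' = c * (t * Q)) → (t ∈ T ↔ t' ∉ T))
    (T' : Finset G) (hTH' : T' ⊆ T₀.1 ∩ T₁.1) (hTm' : T'.card = m)
    (hT' : ∀ t ∈ T₀.1 ∩ T₁.1, ∀ t' ∈ T₀.1, (t' = t * Q ∨ t' = c * (t * Q)) → (t ∈ T' ↔ t' ∉ T'))
    (hfarT : ∀ a ∈ T₀.1 ∩ T₁.1, ∀ a' ∈ T₀.1, (a' = a * Q ∨ a' = c * (a * Q)) →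
      (∀ T₂ ∈ 𝒯, T₂ ≠ T₁ → ∀ X : CMF G c, T₀.1 \ X.1 ⊆ T ∪ {a, a'} →
        (T₀.1 \ X.1).card < ddist T₂ X ∧ (T₀.1 \ X.1).card < ddist (rt c c T₂) X) ∧
      (∀ T₂ ∈ 𝒯, T₂ ≠ T₁ → ∀ X : CMF G c, T₁.1 \ X.1 ⊆ ((T₀.1 \ T₁.1) \ T).image (fun x => c * x) ∪ {a, a'} →
        (T₁.1 \ X.1).card < ddist T₂ X ∧ (T₁.1 \ X.1).card < ddist (rt c c T₂) X)) :
    ∀ a ∈ T₀.1 ∩ T₁.1, (2 : ℤ) • ((Finsupp.single (oflipCM c hc2 a T₀) (1 : ℤ) - Finsupp.single T₀ 1) -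
      (Finsupp.single (oflipCM c hc2 a T₁) (1 : ℤ) - Finsupp.single T₁ 1)) ∈ L := by
  have hHc : (T₀.1 ∩ T₁.1).Nonempty := by
    obtain ⟨x, hx⟩ := card_pos.mp (by rw [hTm']; omega : 0 < T'.card)
    exact ⟨x, hTH' hx⟩
  have hdiff : ∀ a ∈ T₀.1 ∩ T₁.1, ∀ a' ∈ T₀.1, (a' = a * Q ∨ a' = c * (a * Q)) →
      ((Finsupp.single (oflipCM c hc2 a T₀) (1 : ℤ) - Finsupp.single T₀ 1) - (Finsupp.single (oflipCM c hc2 a T₁) (1 : ℤ) - Finsupp.single T₁ 1)) -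
        ((Finsupp.single (oflipCM c hc2 a' T₀) (1 : ℤ) - Finsupp.single T₀ 1) - (Finsupp.single (oflipCM c hc2 a' T₁) (1 : ℤ) - Finsupp.single T₁ 1))
        ∈ L := by
    intro a ha a' ha'0 haa'
    by_cases haT : a ∈ T'
    · exact Y'_sub_Y'_mem_partners c hc2 hcen T₀ 𝒯 hbase m hn hH hpair T₁ hT₁ Q hQ hQQ hσH L hLrt hcover htiesC hP (by omega) T' hTH' hTm' hT'
        haT ha'0 haa'
    · have ha'T : a' ∈ T' := by
        by_contra h; exact haT ((hT' a ha a' ha'0 haa').mpr h)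
      have hback : a = a' * Q ∨ a = c * (a' * Q) := rep_rep c hc2 hQQ haa'
      have h := Y'_sub_Y'_mem_partners c hc2 hcen T₀ 𝒯 hbase m hn hH hpair T₁ hT₁ Q hQ hQQ hσH L hLrt hcover htiesC hP (by omega) T' hTH' hTm'
        hT' ha'T (mem_inter.mp ha).1 hback
      have h' := Submodule.neg_mem _ h
      rwa [neg_sub] at h'
  intro a ha
  obtain ⟨a', ha'0, haa'⟩ := exists_rep c T₀.2 (a * Q)
  have hne : a ≠ a' := ne_rep c hc2 T₀ T₁ m (hH T₁ hT₁) Q hQ hcen (by omega) hHc haa'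
  obtain ⟨hf₀, hf₁⟩ := hfarT a ha a' ha'0 haa'
  have hsum := Y'_add_Y'_mem_partners c hc2 hcen T₀ 𝒯 hbase m hn hH hpair T₁ hT₁ Q hQ hQQ hσH L hLrt hcover hties hm T hTH hTm hT
    (mem_inter.mp ha).1 (mem_inter.mp ha).2 ha'0 haa' hne hf₀ hf₁
  have h := Submodule.add_mem _ hsum (hdiff a ha a' ha'0 haa')
  have e : (2 : ℤ) • ((Finsupp.single (oflipCM c hc2 a T₀) (1 : ℤ) - Finsupp.single T₀ 1) -
      (Finsupp.single (oflipCM c hc2 a T₁) (1 : ℤ) - Finsupp.single T₁ 1)) =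
      ((Finsupp.single (oflipCM c hc2 a T₀) (1 : ℤ) - Finsupp.single T₀ 1) - (Finsupp.single (oflipCM c hc2 a T₁) (1 : ℤ) - Finsupp.single T₁ 1)) +
      ((Finsupp.single (oflipCM c hc2 a' T₀) (1 : ℤ) - Finsupp.single T₀ 1) - (Finsupp.single (oflipCM c hc2 a' T₁) (1 : ℤ) - Finsupp.single T₁ 1)) +
      (((Finsupp.single (oflipCM c hc2 a T₀) (1 : ℤ) - Finsupp.single T₀ 1) - (Finsupp.single (oflipCM c hc2 a T₁) (1 : ℤ) - Finsupp.single T₁ 1)) -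
        ((Finsupp.single (oflipCM c hc2 a' T₀) (1 : ℤ) - Finsupp.single T₀ 1) - (Finsupp.single (oflipCM c hc2 a' T₁) (1 : ℤ) - Finsupp.single T₁ 1)))
      := by module
  rw [e]; exact h

/-! ## §4 `2Y_s` -/

include hc2 hcen hbase hn hH hpair hT₁ hQ hQQ hσH hLrt hP hcover hties htiesC in
/-- **`2Y_s ∈ L` for every `s ∈ 𝓗`** (multi-partner block, `m ≥ 3`): from a transversal `T ⊆ 𝓗` (tie hypothesis `hties`) and a transversal `T' ⊆ T₀ ∩ T₁`
whose companion level-`(m+2)` classes are far from the other partners for every outside pair `{s, σs}` (`hfarT'`). [folklore] -/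
theorem two_smul_Y_mem_partners (hm : 3 ≤ m) (T : Finset G) (hTH : T ⊆ T₀.1 \ T₁.1) (hTm : T.card = m)
    (hT : ∀ t ∈ T₀.1 \ T₁.1, ∀ t' ∈ T₀.1, (t' = t * Q ∨ t' = c * (t * Q)) → (t ∈ T ↔ t' ∉ T))
    (T' : Finset G) (hTH' : T' ⊆ T₀.1 ∩ T₁.1) (hTm' : T'.card = m)
    (hT' : ∀ t ∈ T₀.1 ∩ T₁.1, ∀ t' ∈ T₀.1, (t' = t * Q ∨ t' = c * (t * Q)) → (t ∈ T' ↔ t' ∉ T'))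
    (hfarT' : ∀ s ∈ T₀.1 \ T₁.1, ∀ s' ∈ T₀.1, (s' = s * Q ∨ s' = c * (s * Q)) →
      (∀ T₂ ∈ 𝒯, T₂ ≠ T₁ → ∀ X : CMF G c, T₀.1 \ X.1 ⊆ T' ∪ {s, s'} →
        (T₀.1 \ X.1).card < ddist T₂ X ∧ (T₀.1 \ X.1).card < ddist (rt c c T₂) X) ∧
      (∀ T₂ ∈ 𝒯, T₂ ≠ T₁ → ∀ X : CMF G c,
        (rt c c T₁).1 \ X.1 ⊆ ((T₀.1 \ (rt c c T₁).1) \ T').image (fun x => c * x) ∪ {s, s'} →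
        ((rt c c T₁).1 \ X.1).card < ddist T₂ X ∧ ((rt c c T₁).1 \ X.1).card < ddist (rt c c T₂) X)) :
    ∀ s ∈ T₀.1 \ T₁.1, (2 : ℤ) • ((Finsupp.single (oflipCM c hc2 s T₀) (1 : ℤ) - Finsupp.single T₀ 1) +
      (Finsupp.single (oflipCM c hc2 s T₁) (1 : ℤ) - Finsupp.single T₁ 1)) ∈ L := by
  have hHc : (T₀.1 ∩ T₁.1).Nonempty := by
    obtain ⟨x, hx⟩ := card_pos.mp (by rw [hTm']; omega : 0 < T'.card)
    exact ⟨x, hTH' hx⟩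
  have hdiff : ∀ s ∈ T₀.1 \ T₁.1, ∀ s' ∈ T₀.1, (s' = s * Q ∨ s' = c * (s * Q)) →
      ((Finsupp.single (oflipCM c hc2 s T₀) (1 : ℤ) - Finsupp.single T₀ 1) + (Finsupp.single (oflipCM c hc2 s T₁) (1 : ℤ) - Finsupp.single T₁ 1)) -
        ((Finsupp.single (oflipCM c hc2 s' T₀) (1 : ℤ) - Finsupp.single T₀ 1) + (Finsupp.single (oflipCM c hc2 s' T₁) (1 : ℤ) - Finsupp.single T₁ 1))
        ∈ L := by
    intro s hs s' hs'0 hss'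
    by_cases hsT : s ∈ T
    · exact Y_sub_Y_mem_partners c hc2 hcen T₀ 𝒯 hbase m hn hH hpair T₁ hT₁ Q hQ hQQ hσH L hLrt hcover hties (by omega) T hTH hTm hT hsT hs'0 hss'
    · have hs'T : s' ∈ T := by
        by_contra h; exact hsT ((hT s hs s' hs'0 hss').mpr h)
      have hback : s = s' * Q ∨ s = c * (s' * Q) := rep_rep c hc2 hQQ hss'
      have h := Y_sub_Y_mem_partners c hc2 hcen T₀ 𝒯 hbase m hn hH hpair T₁ hT₁ Q hQ hQQ hσH L hLrt hcover hties (by omega) T hTH hTm hT hs'T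
        (mem_sdiff.mp hs).1 hback
      have h' := Submodule.neg_mem _ h
      rwa [neg_sub] at h'
  intro s hs
  obtain ⟨s', hs'0, hss'⟩ := exists_rep c T₀.2 (s * Q)
  have hne : s ≠ s' := ne_rep c hc2 T₀ T₁ m (hH T₁ hT₁) Q hQ hcen (by omega) hHc hss'
  obtain ⟨hf₀, hf₁⟩ := hfarT' s hs s' hs'0 hss'
  have hsum := Y_add_Y_mem_partners c hc2 hcen T₀ 𝒯 hbase m hn hH hpair T₁ hT₁ Q hQ hQQ hσH L hLrt hP hcover htiesC hm T' hTH' hTm' hT' hs hs'0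
    hss' hne hf₀ hf₁
  have h := Submodule.add_mem _ hsum (hdiff s hs s' hs'0 hss')
  have e : (2 : ℤ) • ((Finsupp.single (oflipCM c hc2 s T₀) (1 : ℤ) - Finsupp.single T₀ 1) +
      (Finsupp.single (oflipCM c hc2 s T₁) (1 : ℤ) - Finsupp.single T₁ 1)) =
      ((Finsupp.single (oflipCM c hc2 s T₀) (1 : ℤ) - Finsupp.single T₀ 1) + (Finsupp.single (oflipCM c hc2 s T₁) (1 : ℤ) - Finsupp.single T₁ 1)) +
      ((Finsupp.single (oflipCM c hc2 s' T₀) (1 : ℤ) - Finsupp.single T₀ 1) + (Finsupp.single (oflipCM c hc2 s' T₁) (1 : ℤ) - Finsupp.single T₁ 1)) +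
      (((Finsupp.single (oflipCM c hc2 s T₀) (1 : ℤ) - Finsupp.single T₀ 1) + (Finsupp.single (oflipCM c hc2 s T₁) (1 : ℤ) - Finsupp.single T₁ 1)) -
        ((Finsupp.single (oflipCM c hc2 s' T₀) (1 : ℤ) - Finsupp.single T₀ 1) + (Finsupp.single (oflipCM c hc2 s' T₁) (1 : ℤ) - Finsupp.single T₁ 1)))
      := by module
  rw [e]; exact h

end Frame

end

end Summit.HodgeConjecture.CorCM.Census.CentralSquares
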